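import Summits.Langlands.Langlands.Theorems.IrreducibilityBySelfDualityReciprocityUpToIrreducibilityRecGLUnramified
import HarnessLib

/-!
# Stub S7' of the line `Sketch` of the crux `ReciprocityUpToIrreducibility`:
# the local deduction from DIVISIBILITY — `rec(π_v)` is unramified with the Satake
# characteristic polynomial

Support file (closes nothing; continuation lead c6, stub S7' `stub_recGL_unramified_of_dvd`).

Let `d` be a local Langlands datum of the non-archimedean local field `F`, `π_v` an irreducible
smooth `ψ`-generic representation of `GL_n(F)` (`2 ≤ n`), and `α` a multiset of `n` NON-ZERO complex
numbers such that every JPSS `L`-polynomial `P` of the pair `(π_v, 1_{GL₁})` for `ψ` (w.r.t. any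
invariant Radon measure of full support on `GL₁(F) ⧸ U₁`) is divisible by `∏_{a ∈ α} (1 - a T)`.
Then every Frobenius-semisimple representative `A` of `d.recGL n ⟦π_v⟧` has `N = 0`, is trivial on
inertia, and `char(A.ρ Φ) = ∏_{a ∈ α} (X - a)` at every geometric Frobenius `Φ`.

This is the proof of stub H4 (`recGL_out_unramified_of_isSatakeParameter_recGLn`, FILE
`…RecGLUnramified`) with its one use of the Jacquet–Shalika unramified computation replaced by the
divisibility premise: clause (iii-L) `lFactor_pairs` of `d` gives `HasRSLFactor (π_v, 1) P₀` for the
Euler factor `P₀ = det(1 - TΦ | (A₀ ⊗ rec 1)^{I, N = 0})` of `A₀ ⊗ rec(1)`, `A₀ := (d.recGL n ⟦π_v⟧).out`;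
`deg P₀ ≤ dim = n` (`natDegree_eulerFactor_le`), `∏ (1 - a T) ∣ P₀` (premise),
`deg ∏ (1 - a T) = n` (all `a ≠ 0`) and `P₀(0) = 1` force `P₀ = ∏ (1 - a T)`
(`eq_of_dvd_of_natDegree_le_of_eval_zero_recGLn`); from there on verbatim: `rec(1) ≅ (1 ∘ artin, 0)`
by clause (ii), full degree gives `(ker N)^I = A₀ ⊗ rec(1)`
(`inertiaInvariantsKerN_eq_top_of_natDegree_eulerFactor_eq`,
`N_eq_zero_and_inertia_trivial_of_tprod_eq_top`), `det(1 - TΦ₀ | A₀) = ∏ (1 - a T)`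
(`eulerFactor_eq_reverse_charpoly_of_eq_top`, `charpoly_tprod_ρ_eq`), i.e.
`char(A₀.ρ Φ₀) = ∏ (X - a)` by reflection in degree `n`; this passes to the equivalent `A` and to
every geometric Frobenius (two of them differ by inertia).  No definitions; std axioms.

## References

* M. Harris, R. Taylor, Ann. of Math. Stud. 151 (2001), Thm. A (ii), (v). [HarrisTaylorAMS2001]
* J. Tate, *Number theoretic background*, Corvallis 1979, (4.1.6). [TateCorvallis1979]
* H. Jacquet, I. I. Piatetskii-Shapiro, J. A. Shalika, Amer. J. Math. 105 (1983), Thm. 2.7. [JPSS1983]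
-/

open scoped MatrixGroups Matrix NumberField Classical Polynomial
open Filter IsDedekindDomain Field Polynomial Literature.NumberTheory.Automorphic
  Literature.NumberTheory.GaloisRepresentations Literature.NumberTheory.PAdicHodge Summit.Langlands

noncomputable section
set_option linter.dupNamespace false -- project-wide option (lakefile weak.linter.dupNamespace); `Summit.Langlands.Langlands` is the mandated namespace

namespace Summit.Langlands.Langlands.Theorems.ReciprocityUpToIrreducibility

open Literature.NumberTheory.EllipticCurves.Hida2000Thm326 (exists_haar_measure_quotient_fin_one)

/-! ### Polynomial endgame: a divisor of the same degree with the same constant term `1` -/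

/-- If `D ∣ P` in `ℂ[X]`, `deg P ≤ deg D` and `D(0) = 1 = P(0)`, then `P = D`: the cofactor is a
constant (degree count), equal to `1` (compare constant terms). [folklore] -/
theorem eq_of_dvd_of_natDegree_le_of_eval_zero_recGLn {P D : ℂ[X]} (hdvd : D ∣ P)
    (hdeg : P.natDegree ≤ D.natDegree) (hD0 : D.eval 0 = 1) (hP0 : P.eval 0 = 1) : P = D := by
  obtain ⟨E, hE⟩ := hdvd
  have hPne : P ≠ 0 := fun h => by simp [h] at hP0
  have hDne : D ≠ 0 := fun h => by simp [h] at hD0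
  have hEne : E ≠ 0 := by
    rintro rfl
    exact hPne (by rw [hE, mul_zero])
  have hdegE : E.natDegree = 0 := by
    have h := Polynomial.natDegree_mul hDne hEne
    rw [← hE] at h
    omega
  obtain ⟨e, rfl⟩ := Polynomial.natDegree_eq_zero.1 hdegE
  -- compare constant terms: `P(0) = D(0) e = e`
  have he : e = 1 := by
    have h := hP0
    rw [hE, Polynomial.eval_mul, hD0, one_mul, Polynomial.eval_C] at h
    exact h
  rw [hE, he, map_one, mul_one]

/-! ### The local deduction at a generic `π_v` of `GL_n(F)` from divisibility -/

section Local

variable {F : Type} [Field F] [ValuativeRel F] [TopologicalSpace F] [IsNonarchimedeanLocalField F]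

/-- **The chosen representative of `rec(π_v)` is unramified with the prescribed characteristic
polynomial, from divisibility.**  Let `d` be a local Langlands datum of `F`, `π_v` an irreducible
smooth `ψ`-generic representation of `GL_n(F)` (`2 ≤ n`), and `α` a multiset of `n` non-zero
numbers such that every JPSS `L`-polynomial of `(π_v, 1_{GL₁})` for `ψ` is divisible by
`∏_{a ∈ α} (1 - a T)` (hypothesis `hdvd`).  Then `A₀ := (d.recGL n ⟦π_v⟧).out` has `N = 0`, trivial
inertia action, and `char(A₀.ρ Φ₀) = ∏_{a ∈ α} (X - a)` at the chosen geometric Frobenius `Φ₀`: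
clause (iii-L) of `d` (with `1_{GL₁}` generic for `ψ⁻¹`, `ν` an invariant measure on `GL₁(F) ⧸ U₁`)
gives `HasRSLFactor (π_v, 1) P₀` for the Euler factor `P₀` of `A₀ ⊗ rec(1)`; `deg P₀ ≤ n = dim`,
`∏ (1 - a T) ∣ P₀`, `deg ∏ (1 - a T) = n` and `P₀(0) = 1` give `P₀ = ∏ (1 - a T)`;
`rec(1) ≅ (1 ∘ artin, 0)` by clause (ii); the Euler factor has degree `n = dim`, whence
`(ker N)^I = A₀ ⊗ rec(1)`, `N = 0`, inertia trivial, and `det(1 - TΦ₀ | A₀) = ∏ (1 - a T)`, i.e.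
`char(A₀.ρ Φ₀) = ∏ (X - a)` by reflection in degree `n`.
[cite: HarrisTaylorAMS2001, Thm. A (ii), (v)] [cite: TateCorvallis1979, (4.1.6)]
[cite: JPSS1983, Thm. 2.7 (i)–(ii)] -/
theorem recGL_out_unramified_of_dvd_recGLn (d : LocalLanglandsDatum F) {n : ℕ}
    (hn : 1 < n) (πv : SmoothIrrep (GL (Fin n) F)) {ψ : AddChar F Circle}
    (hψ : ψ.IsContinuousNontrivial) (hgen : IsGeneric πv.ρ ψ) {α : Multiset ℂ}
    (hcard : Multiset.card α = n) (hne : ∀ a ∈ α, a ≠ 0)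
    (hdvd : ∀ [MeasurableSpace (GL (Fin 1) F ⧸ upperUnitriangular (Fin 1) F)]
        [BorelSpace (GL (Fin 1) F ⧸ upperUnitriangular (Fin 1) F)]
        (ν : MeasureTheory.Measure (GL (Fin 1) F ⧸ upperUnitriangular (Fin 1) F))
        [MeasureTheory.SMulInvariantMeasure (GL (Fin 1) F)
          (GL (Fin 1) F ⧸ upperUnitriangular (Fin 1) F) ν]
        [MeasureTheory.IsFiniteMeasureOnCompacts ν] [ν.IsOpenPosMeasure] (P : ℂ[X]),
        HasRSLFactor hn πv.ρ (Representation.trivial ℂ (GL (Fin 1) F) ℂ) ψ ν P →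
          (α.map fun a => (1 : ℂ[X]) - C a * X).prod ∣ P) :
    ((d.recGL n (IrrClass.mk πv)).out.1).N = 0 ∧
      (∀ u ∈ WeilGroup.inertia F, ((d.recGL n (IrrClass.mk πv)).out.1).ρ u = 1) ∧
      (((d.recGL n (IrrClass.mk πv)).out.1).ρ (WeilDeligneRep.geomFrob F d.hex)).charpoly =
        (α.map fun a => X - C a).prod := by
  classical
  haveI := πv.isIrreducible
  haveI hirr1 : (Representation.trivial ℂ (GL (Fin 1) F) ℂ).IsIrreducible :=
    isIrreducible_trivial_complex _
  have hadm1 : (Representation.trivial ℂ (GL (Fin 1) F) ℂ).IsAdmissible :=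
    isAdmissible_trivial_complex _
  -- an invariant measure on `GL₁(F) ⧸ U₁`, finite on compacts and positive on opens
  letI : MeasurableSpace F := borel F
  haveI : BorelSpace F := ⟨rfl⟩
  letI : MeasurableSpace (GL (Fin 1) F ⧸ upperUnitriangular (Fin 1) F) := borel _
  haveI : BorelSpace (GL (Fin 1) F ⧸ upperUnitriangular (Fin 1) F) := ⟨rfl⟩
  obtain ⟨_, _, ν, hinv, hfin, hpos, -⟩ := exists_haar_measure_quotient_fin_one (F := F)
  haveI := hinv
  haveI := hfin
  haveI := hpos
  -- the trivial irreducible smooth representation of `GL₁(F)` on `ℂ`, generic for `ψ⁻¹`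
  let π' : SmoothIrrep (GL (Fin 1) F) :=
    { V := ℂ
      ρ := Representation.trivial ℂ (GL (Fin 1) F) ℂ
      isIrreducible := hirr1
      isSmooth := hadm1.isSmooth }
  have hgen' : IsGeneric π'.ρ ψ⁻¹ := isGeneric_of_fin_one _ _
  -- (iii-L): the Euler factor `P₀` of `A₀ ⊗ B₀` is a JPSS `L`-polynomial of `(π_v, 1)`
  set A₀ := (d.recGL n (IrrClass.mk πv)).out.1 with hA₀
  set B₀ := (d.recGL 1 (IrrClass.mk π')).out.1 with hB₀
  set P₀ : ℂ[X] := (A₀.tprod B₀).eulerFactor d.hn d.hex with hP₀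
  have hRS : HasRSLFactor hn πv.ρ π'.ρ ψ ν P₀ :=
    (d.isLocalLanglands.lFactor_pairs Nat.one_pos hn πv π' ψ hψ hgen hgen' ν P₀).mpr hP₀
  -- `deg P₀ ≤ dim (A₀ ⊗ B₀) = n`, `∏ (1 - a T) ∣ P₀`, `deg ∏ (1 - a T) = n`, `P₀(0) = 1`:
  -- so `P₀ = ∏ (1 - a T)`
  have hfr : Module.finrank ℂ (TensorProduct ℂ (Fin n → ℂ) (Fin 1 → ℂ)) = n := by
    rw [Module.finrank_tensorProduct, Module.finrank_fin_fun, Module.finrank_fin_fun, mul_one]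
  have hdegle : P₀.natDegree ≤ n :=
    (natDegree_eulerFactor_le _ d.hn d.hex).trans ((Submodule.finrank_le _).trans hfr.le)
  have hDdeg : ((α.map fun a => (1 : ℂ[X]) - C a * X).prod).natDegree = n := by
    rw [natDegree_prod_one_sub_C_mul_X_recGLn hne, hcard]
  have hD0 : ((α.map fun a => (1 : ℂ[X]) - C a * X).prod).eval 0 = 1 := by
    simp [eval_multiset_prod]
  have hPeq : P₀ = (α.map fun a => (1 : ℂ[X]) - C a * X).prod :=
    eq_of_dvd_of_natDegree_le_of_eval_zero_recGLn (hdvd ν P₀ hRS) (hDdeg.symm ▸ hdegle) hD0 hRS.1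
  -- (ii): `B₀ ≅ (1 ∘ artin, 0)`, so `B₀.N = 0` and `B₀.ρ = 1`
  have hgl : B₀.IsEquivalent (WeilDeligneRep.ofQuasiChar d.hns d.artin 1) :=
    d.isLocalLanglands.gl_one 1 π' fun g v => by simp [π']
  obtain ⟨e⟩ := hgl
  set φ : (Fin 1 → ℂ) ≃ₗ[ℂ] ℂ := e.toRepEquiv.toLinearEquiv with hφ
  have hφρ : ∀ (u : WeilGroup F) (y : Fin 1 → ℂ),
      φ (B₀.ρ u y) = (WeilDeligneRep.ofQuasiChar d.hns d.artin 1).ρ u (φ y) := fun u y => by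
    rw [hφ, Representation.Equiv.toLinearEquiv_apply, Representation.Equiv.toLinearEquiv_apply]
    exact Representation.IntertwiningMap.isIntertwining _ _ e.toRepEquiv.toIntertwiningMap u y
  have hφN : ∀ y : Fin 1 → ℂ, φ (B₀.N y) = (WeilDeligneRep.ofQuasiChar d.hns d.artin 1).N (φ y) :=
    fun y => LinearMap.congr_fun e.comm_N y
  have hBρ : ∀ (u : WeilGroup F) (y : Fin 1 → ℂ), B₀.ρ u y = y := by
    intro u y
    apply φ.injective
    rw [hφρ, WeilDeligneRep.ofQuasiChar_ρ_apply]
    simp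
  have hBN : B₀.N = 0 := by
    refine LinearMap.ext fun y => φ.injective ?_
    rw [hφN, WeilDeligneRep.ofQuasiChar_N, LinearMap.zero_apply, LinearMap.zero_apply, map_zero]
  -- the Euler factor has degree `n = dim (A₀ ⊗ B₀)`, so `(ker N)^I` is everything
  have hPdeg : P₀.natDegree = n := by rw [hPeq, hDdeg]
  have htop : (A₀.tprod B₀).inertiaInvariantsKerN = ⊤ :=
    inertiaInvariantsKerN_eq_top_of_natDegree_eulerFactor_eq _ d.hn d.hex (hPdeg.trans hfr.symm)
  obtain ⟨hAN, hAρ⟩ := N_eq_zero_and_inertia_trivial_of_tprod_eq_top A₀ B₀ hBN hBρ htop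
  -- the Euler factor is the reversed characteristic polynomial of `A₀.ρ Φ₀`
  have hrev : (A₀.ρ (WeilDeligneRep.geomFrob F d.hex)).charpoly.reverse =
      (α.map fun a => (1 : ℂ[X]) - C a * X).prod := by
    rw [← charpoly_tprod_ρ_eq A₀ B₀ hBρ (WeilDeligneRep.geomFrob F d.hex),
      ← eulerFactor_eq_reverse_charpoly_of_eq_top _ d.hn d.hex htop, ← hP₀, hPeq]
  refine ⟨hAN, hAρ, eq_prod_X_sub_C_of_reverse_eq_recGLn ?_ hrev⟩
  rw [LinearMap.charpoly_natDegree, Module.finrank_fin_fun, hcard]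

/-- **Every Frobenius-semisimple representative of `rec(π_v)` is unramified with the prescribed
characteristic polynomial at every geometric Frobenius, from divisibility**: under the hypotheses of
`recGL_out_unramified_of_dvd_recGLn`, for `A` Frobenius-semisimple with `d.recGL n ⟦π_v⟧ = ⟦A⟧`,
`A.N = 0`, `A.ρ` is trivial on inertia, and `char(A.ρ Φ) = ∏_{a ∈ α} (X - a)` whenever
`deg Φ = -1`.  From `recGL_out_unramified_of_dvd_recGLn` by `A ≅ (d.recGL n ⟦π_v⟧).out`
(`Quotient.exact`) and `A.ρ Φ = A.ρ Φ₀` (the two geometric Frobenii differ by inertia).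
[cite: HarrisTaylorAMS2001, Thm. A (ii), (v)] [cite: TateCorvallis1979, (4.1.6)] -/
theorem recGL_unramified_of_dvd_recGLn (d : LocalLanglandsDatum F) {n : ℕ} (hn : 1 < n)
    (πv : SmoothIrrep (GL (Fin n) F)) {ψ : AddChar F Circle} (hψ : ψ.IsContinuousNontrivial)
    (hgen : IsGeneric πv.ρ ψ) {α : Multiset ℂ} (hcard : Multiset.card α = n)
    (hne : ∀ a ∈ α, a ≠ 0)
    (hdvd : ∀ [MeasurableSpace (GL (Fin 1) F ⧸ upperUnitriangular (Fin 1) F)]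
        [BorelSpace (GL (Fin 1) F ⧸ upperUnitriangular (Fin 1) F)]
        (ν : MeasureTheory.Measure (GL (Fin 1) F ⧸ upperUnitriangular (Fin 1) F))
        [MeasureTheory.SMulInvariantMeasure (GL (Fin 1) F)
          (GL (Fin 1) F ⧸ upperUnitriangular (Fin 1) F) ν]
        [MeasureTheory.IsFiniteMeasureOnCompacts ν] [ν.IsOpenPosMeasure] (P : ℂ[X]),
        HasRSLFactor hn πv.ρ (Representation.trivial ℂ (GL (Fin 1) F) ℂ) ψ ν P →
          (α.map fun a => (1 : ℂ[X]) - C a * X).prod ∣ P)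
    (A : WeilDeligneRep F ℂ (Fin n → ℂ)) (hA : A.IsFrobSemisimple)
    (hrec : d.recGL n (IrrClass.mk πv) = Quotient.mk (frobSemisimpleWDSetoid F n) ⟨A, hA⟩) :
    A.N = 0 ∧ WeilGroup.IsUnramifiedRep A.ρ ∧
      ∀ Φ : WeilGroup F, WeilGroup.deg Φ = -1 →
        (A.ρ Φ).charpoly = (α.map fun a => X - C a).prod := by
  obtain ⟨hAN, hAρ, hch⟩ := recGL_out_unramified_of_dvd_recGLn d hn πv hψ hgen hcard hne hdvd
  have hAA : ((d.recGL n (IrrClass.mk πv)).out.1).IsEquivalent A :=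
    Quotient.exact ((Quotient.out_eq _).trans hrec)
  obtain ⟨hN, hur, hchar⟩ := wd_unramified_charpoly_of_isEquivalent_recGLn hAA.symm hAN hAρ
  refine ⟨hN, hur, fun Φ hΦ => ?_⟩
  rw [wd_apply_eq_of_isUnramifiedRep_of_deg_eq_recGLn hur
      (hΦ.trans (WeilDeligneRep.deg_geomFrob d.hmul d.huniq d.hex).symm), hchar, hch]

end Local

/-! ### The registered stub -/

/-- **stub S7' (the local deduction from DIVISIBILITY: `rec(π_v)` is unramified with the Satake
characteristic polynomial).**  Let `d` be a local Langlands datum of `F`, `π_v` an irreducible smooth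
`ψ`-generic representation of `GL_n(F)` (`2 ≤ n`), and `α` a multiset of `n` NON-ZERO numbers such that
every JPSS `L`-polynomial `P` of the pair `(π_v, 1)` for `ψ` (any invariant Radon full-support `ν`) is
divisible by `∏_{a ∈ α} (1 - a T)`.  Then every Frobenius-semisimple representative `A` of
`d.recGL n ⟦π_v⟧` has `N = 0`, is trivial on inertia, and `char(A.ρ Φ) = ∏_{a ∈ α} (X - a)` at every
geometric Frobenius `Φ`.  H4's proof (`recGL_out_unramified_of_isSatakeParameter_recGLn`,
`RecGLUnramified`) with its step "`HasRSLFactor (π_v, 1) (∏ (1 - a T))`" replaced by: clause (iii-L)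
gives `HasRSLFactor (π_v, 1) P₀` for `P₀ = det(1 - TΦ | (A₀ ⊗ rec 1)^{I,N=0})` (`lFactor_pairs … .mpr rfl`),
`deg P₀ ≤ n` (`natDegree_eulerFactor_le`), `∏ (1 - a T) ∣ P₀` (hypothesis), `deg ∏ (1 - a T) = n`
(`natDegree_prod_one_sub_C_mul_X_recGLn`), `P₀(0) = 1` (`HasRSLFactor.1`) ⇒ `P₀ = ∏ (1 - a T)`; then
verbatim (`recGL_unramified_of_dvd_recGLn`).  [cite: HarrisTaylorAMS2001, Thm. A (ii), (v)]
[cite: TateCorvallis1979, (4.1.6)] [cite: JPSS1983, Thm. 2.7 (i)–(ii)] -/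
theorem stub_recGL_unramified_of_dvd :
    ∀ (F : Type) [Field F] [ValuativeRel F] [TopologicalSpace F] [IsNonarchimedeanLocalField F]
      (d : LocalLanglandsDatum F) (n : ℕ) (hn : 1 < n) (πv : SmoothIrrep (GL (Fin n) F))
      (ψ : AddChar F Circle), ψ.IsContinuousNontrivial → IsGeneric πv.ρ ψ →
      ∀ (α : Multiset ℂ), Multiset.card α = n → (∀ a ∈ α, a ≠ 0) →
      (∀ [MeasurableSpace (GL (Fin 1) F ⧸ upperUnitriangular (Fin 1) F)]
          [BorelSpace (GL (Fin 1) F ⧸ upperUnitriangular (Fin 1) F)]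
          (ν : MeasureTheory.Measure (GL (Fin 1) F ⧸ upperUnitriangular (Fin 1) F))
          [MeasureTheory.SMulInvariantMeasure (GL (Fin 1) F) (GL (Fin 1) F ⧸ upperUnitriangular (Fin 1) F) ν]
          [MeasureTheory.IsFiniteMeasureOnCompacts ν] [ν.IsOpenPosMeasure] (P : ℂ[X]),
          HasRSLFactor hn πv.ρ (Representation.trivial ℂ (GL (Fin 1) F) ℂ) ψ ν P →
            (α.map fun a => (1 : ℂ[X]) - C a * X).prod ∣ P) →
      ∀ (A : WeilDeligneRep F ℂ (Fin n → ℂ)) (hA : A.IsFrobSemisimple),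
        d.recGL n (IrrClass.mk πv) = Quotient.mk (frobSemisimpleWDSetoid F n) ⟨A, hA⟩ →
        A.N = 0 ∧ WeilGroup.IsUnramifiedRep A.ρ ∧
          ∀ Φ : WeilGroup F, WeilGroup.deg Φ = -1 →
            (A.ρ Φ).charpoly = (α.map fun a => X - C a).prod := by
  intro F _ _ _ _ d n hn πv ψ hψ hgen α hcard hne hdvd A hA hrec
  exact recGL_unramified_of_dvd_recGLn d hn πv hψ hgen hcard hne hdvd A hA hrec

end Summit.Langlands.Langlands.Theorems.ReciprocityUpToIrreducibility
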